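import Summits.BirchSwinnertonDyer.BirchSwinnertonDyer.Theorems.GenusKolyvaginAtTwoTorsionCellSELLaplacianAlgebra
import Summits.BirchSwinnertonDyer.BirchSwinnertonDyer.Theorems.GenusKolyvaginAtTwoTorsionCellSELIsoClassSymbols
import HarnessLib

/-!
# SEL (iso-class Selmer pair law), V-b: `𝟙ᵀĜ = 𝟙ᵀ` in matrix form and the evenness of every solution

Crux R″ `RankOneTwoTorsionResidualAtTwo` (stmt-27478), LINE 49 «full_vertex», SUPPORT stub SEL
`IsoClassSelmerPairLawAtTwo`.  The conversions between the `↥Q`-indexed vectors of `…FullVertexDefs` /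
`…SELLaplacianAlgebra` and the `ℕ`-indexed inline sums of parts I–IV, and their first consequence:

* `sum_univ_ite_eq_sum_erase` — `Σ_{i : Q, i ≠ j} F i = Σ_{i ∈ Q∖j} F i`; `legendreBit_eq_ite` (the Defs' `legendreBit`
  IS the inline symbol of parts I–IV, by `rfl`).
* `mulVec_redeiLaplacian_apply_eq_sum_erase` — `(Ĝχ) j` in the inline form of part II's rows.
* `sum_mulVec_redeiLaplacian_eq` — `Σ_j (Ĝχ) j = Σ_j χ j` for a set `Q` of primes `≡ 3 (mod 4)` of even size
  (part I's `sum_laplacian_apply_eq_sum`).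
* `sum_eq_zero_of_phi3_mulVec_eq_const` / `sum_eq_zero_of_rows` — every solution of `Φ₃(Ĝ)χ = c𝟙`, and both vectors of
  every solution of the row system, have an EVEN number of ones (so parts III/IV apply to every abstract solution).

Everything is proved; no LINE 49 statement is restated; BSD is not advanced by this file alone.

## References

* [HeathBrown1994SelmerCongruentII] D. R. Heath-Brown, Invent. Math. 118 (1994), §2.
* [Kane2013SelmerTwists] D. M. Kane, Algebra Number Theory 7 (2013), §2.
-/

namespace Summit.BirchSwinnertonDyer.BirchSwinnertonDyer.Theorems.GenusKolyvaginAtTwo.FullVertex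

open Matrix
open Summit.BirchSwinnertonDyer.BirchSwinnertonDyer.Theorems.GenusKolyvaginAtTwo.TorsionCellSEL

variable (Q : Finset ℕ)

/-! ## Conversions `↥Q ↔ Q` -/

/-- `Σ_{i : Q} (if i = j then 0 else F i) = Σ_{i ∈ Q∖j} F i`. [folklore] -/
theorem sum_univ_ite_eq_sum_erase {M : Type*} [AddCommMonoid M] (F : ℕ → M) (j : Q) :
    (∑ i : Q, if i = j then 0 else F i) = ∑ i ∈ Q.erase j, F i := by
  classical
  have h1 : (∑ i : Q, if i = j then 0 else F i) = ∑ i ∈ Q, if i = (j : ℕ) then 0 else F i := by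
    rw [← Finset.sum_coe_sort Q]
    refine Finset.sum_congr rfl fun i _ => ?_
    by_cases hij : i = j
    · subst hij; simp
    · have : (i : ℕ) ≠ (j : ℕ) := fun h => hij (Subtype.ext h)
      rw [if_neg hij, if_neg this]
  rw [h1, ← Finset.add_sum_erase Q _ j.2, if_pos rfl, zero_add]
  exact Finset.sum_congr rfl fun i hi => by rw [if_neg (Finset.ne_of_mem_erase hi)]

/-- The Defs' `legendreBit (−i) j` is the inline symbol `[−i/j]` of parts I–IV. [cite: HeathBrown1994SelmerCongruentII, §2] -/
theorem legendreBit_eq_ite (i j : ℕ) :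
    legendreBit (-(i : ℤ)) j = (if jacobiSym (-(i : ℤ)) j = -1 then (1 : ZMod 2) else 0) := rfl

/-- **`(Ĝχ) j` in the inline form of part II**: `Σ_{i∈Q∖j} [−i/j]·χ i + (Σ_{i∈Q∖j} [−i/j])·χ j`, for a vector
given on `ℕ` and restricted to `Q`. [cite: HeathBrown1994SelmerCongruentII, §2] -/
theorem mulVec_redeiLaplacian_apply_eq_sum_erase (p : ℕ → ZMod 2) (j : Q) :
    (redeiLaplacian Q *ᵥ fun i : Q => p i) j =
      (∑ i ∈ Q.erase j, (if jacobiSym (-(i : ℤ)) j = -1 then (1 : ZMod 2) else 0) * p i) +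
        (∑ i ∈ Q.erase j, (if jacobiSym (-(i : ℤ)) j = -1 then (1 : ZMod 2) else 0)) * p j := by
  rw [mulVec_redeiLaplacian_apply]
  congr 1
  · rw [← sum_univ_ite_eq_sum_erase Q (fun i => (if jacobiSym (-(i : ℤ)) j = -1 then (1 : ZMod 2) else 0) * p i) j]
    refine Finset.sum_congr rfl fun i _ => ?_
    by_cases hij : i = j
    · rw [if_pos hij, if_pos hij, zero_mul]
    · rw [if_neg hij, if_neg hij, legendreBit_eq_ite]
  · congr 1
    rw [← sum_univ_ite_eq_sum_erase Q (fun i => (if jacobiSym (-(i : ℤ)) j = -1 then (1 : ZMod 2) else 0)) j]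
    refine Finset.sum_congr rfl fun i _ => ?_
    by_cases hij : i = j
    · rw [if_pos hij, if_pos hij]
    · rw [if_neg hij, if_neg hij, legendreBit_eq_ite]

/-! ## `𝟙ᵀĜ = 𝟙ᵀ` and evenness -/

variable (hQ : ∀ q ∈ Q, q.Prime) (hQ4 : ∀ q ∈ Q, q % 4 = 3) (hk : Even Q.card)
include hQ hQ4 hk

/-- **`Σ_j (Ĝχ) j = Σ_j χ j`** for a set `Q` of primes `≡ 3 (mod 4)` of even size (the column sums of the tournament
are `1 + g`; part I). [cite: HeathBrown1994SelmerCongruentII, §2] -/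
theorem sum_mulVec_redeiLaplacian_eq (χ : Q → ZMod 2) : ∑ j : Q, (redeiLaplacian Q *ᵥ χ) j = ∑ j : Q, χ j := by
  classical
  -- extend `χ` to `ℕ`
  set p : ℕ → ZMod 2 := fun i => if hi : i ∈ Q then χ ⟨i, hi⟩ else 0 with hp
  have hχ : χ = fun i : Q => p i := by
    ext i; rw [hp]; simp only [dif_pos i.2]
  rw [hχ]
  have h1 : (∑ j : Q, (redeiLaplacian Q *ᵥ fun i : Q => p i) j) =
      ∑ j ∈ Q, ((∑ i ∈ Q.erase j, (if jacobiSym (-(i : ℤ)) j = -1 then (1 : ZMod 2) else 0) * p i) +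
        (∑ i ∈ Q.erase j, (if jacobiSym (-(i : ℤ)) j = -1 then (1 : ZMod 2) else 0)) * p j) := by
    rw [← Finset.sum_coe_sort Q]
    exact Finset.sum_congr rfl fun j _ => mulVec_redeiLaplacian_apply_eq_sum_erase Q p j
  rw [h1, sum_laplacian_apply_eq_sum Q hQ hQ4 hk p, ← Finset.sum_coe_sort Q]

/-- **Every solution of `Φ₃(Ĝ)χ = c𝟙` has an even number of ones**: `Σ_j χ j = 𝟙ᵀΦ₃(Ĝ)χ = c·#Q = 0`.
[cite: HeathBrown1994SelmerCongruentII, §2] [cite: Kane2013SelmerTwists, §2] -/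
theorem sum_eq_zero_of_phi3_mulVec_eq_const {χ : Q → ZMod 2} {c : ZMod 2}
    (h : phi3 (redeiLaplacian Q) *ᵥ χ = fun _ => c) : ∑ j : Q, χ j = 0 := by
  classical
  have hsum : (∑ j : Q, (phi3 (redeiLaplacian Q) *ᵥ χ) j) = ∑ j : Q, (fun _ : Q => c) j := by rw [h]
  unfold phi3 at hsum
  rw [add_mulVec, add_mulVec, one_mulVec, ← mulVec_mulVec] at hsum
  simp only [Pi.add_apply, Finset.sum_add_distrib] at hsum
  rw [sum_mulVec_redeiLaplacian_eq Q hQ hQ4 hk, sum_mulVec_redeiLaplacian_eq Q hQ hQ4 hk, CharTwo.add_self_eq_zero,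
    zero_add, Finset.sum_const, Finset.card_univ, Fintype.card_coe, nsmul_eq_mul] at hsum
  obtain ⟨r, hr⟩ := hk
  rw [hr, ← two_mul, Nat.cast_mul, show ((2 : ℕ) : ZMod 2) = 0 by decide, zero_mul, zero_mul] at hsum
  exact hsum

/-- **Both vectors of every solution of the row system have an even number of ones** (`χ_b = τ₁𝟙 + Ĝχ_a + εχ_a`, and
`Σ Ĝχ_a = Σ χ_a = 0`). [cite: HeathBrown1994SelmerCongruentII, §2] [cite: Kane2013SelmerTwists, §2] -/
theorem sum_eq_zero_of_rows {ε τ₁ τ₂ : ZMod 2} {χa χb : Q → ZMod 2}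
    (h1 : ∀ j : Q, (redeiLaplacian Q *ᵥ χa) j + ε * χa j + χb j = τ₁)
    (h2 : ∀ j : Q, (redeiLaplacian Q *ᵥ χb) j + (ε + 1) * χb j + χa j = τ₂) :
    ∑ j : Q, χa j = 0 ∧ ∑ j : Q, χb j = 0 := by
  classical
  obtain ⟨hb, hphi⟩ := (rows_iff_phi3 Q ε τ₁ τ₂ χa χb).mp ⟨h1, h2⟩
  have ha : ∑ j : Q, χa j = 0 := sum_eq_zero_of_phi3_mulVec_eq_const Q hQ hQ4 hk hphi
  refine ⟨ha, ?_⟩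
  rw [hb]
  simp only [Finset.sum_add_distrib, ← Finset.mul_sum]
  rw [sum_mulVec_redeiLaplacian_eq Q hQ hQ4 hk, ha, mul_zero, add_zero, add_zero, Finset.sum_const, Finset.card_univ,
    Fintype.card_coe, nsmul_eq_mul]
  obtain ⟨r, hr⟩ := hk
  rw [hr, ← two_mul, Nat.cast_mul, show ((2 : ℕ) : ZMod 2) = 0 by decide, zero_mul, zero_mul]

end Summit.BirchSwinnertonDyer.BirchSwinnertonDyer.Theorems.GenusKolyvaginAtTwo.FullVertex
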